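import Literature.NumberTheory.EllipticCurves.VariableChangePoints
import HarnessLib

/-!
# Points under a change of variables, II: base change and functoriality

Companion to `Literature.NumberTheory.EllipticCurves.VariableChangePoints`, whose
`VariableChange.pointEquiv W C : W(F) ≃+ (C • W)(F)` is the group isomorphism induced by an
admissible change of variables `C` over `F` (Silverman, *AEC*, III.1 and III.3.1(b)). Here:

* `Affine.Point.congrEquiv h : W₁(F) ≃+ W₂(F)` for an *equality* `h : W₁ = W₂` of Weierstrass
  equations (identity on coordinates) — the device needed whenever a change of variables lands on
  an equation merely equal to the target one (e.g. `(C • W).baseChange L` versus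
  `C_L • W.baseChange L`, Mathlib `map_variableChange`);
* `VariableChange.pointEquivBaseChange W C L : W(L) ≃+ (C • W)(L)` for a change of variables `C`
  defined over the base field `F` and any extension `L/F` (the substitution with the coefficients
  of `C` viewed in `L`);
* functoriality in `L`: for an `F`-algebra homomorphism `f : L → L'`,
  `Point.map f ∘ pointEquivBaseChange W C L = pointEquivBaseChange W C L' ∘ Point.map f`
  (`pointEquivBaseChange_map`); in particular the isomorphism `W(L) ≃+ (C • W)(L)` commutes with
  the action of `Aut(L/F)` (`pointEquivBaseChange_map_algEquiv`), i.e. it is an isomorphism of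
  Galois modules (Silverman, *AEC*, X.§4: isomorphic curves have isomorphic `H¹` and `Ш`).

Everything here is proved.

## References

* J. H. Silverman, *The Arithmetic of Elliptic Curves*, 2nd ed., GTM 106 (2009), III.1
  (Table 3.1), III.3.1(b), VIII.§1 (Galois action on points), X.§4.
-/

noncomputable section

namespace WeierstrassCurve

universe u v w

/-! ### Transport of points along an equality of Weierstrass equations -/

section Congr

variable {F : Type u} [Field F] [DecidableEq F]

/-- Transport of the group of points along an equality `W₁ = W₂` of Weierstrass equations (the
identity map on coordinates). An auxiliary device: `VariableChange.pointEquiv W C` lands in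
`(C • W)⟮F⟯`, and one needs it on an equation merely *equal* to `C • W`. [folklore] -/
def Affine.Point.congrEquiv {W₁ W₂ : WeierstrassCurve F} (h : W₁ = W₂) :
    W₁.toAffine.Point ≃+ W₂.toAffine.Point :=
  h ▸ AddEquiv.refl _

/-- `congrEquiv` is the identity on coordinates. [folklore] -/
theorem Affine.Point.congrEquiv_some {W₁ W₂ : WeierstrassCurve F} (h : W₁ = W₂) {x y : F}
    (hP : W₁.toAffine.Nonsingular x y) :
    Affine.Point.congrEquiv h (.some x y hP) = .some x y (h ▸ hP) := by
  subst h
  rfl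

/-- `congrEquiv` maps `𝒪` to `𝒪`. [folklore] -/
theorem Affine.Point.congrEquiv_zero {W₁ W₂ : WeierstrassCurve F} (h : W₁ = W₂) :
    Affine.Point.congrEquiv h 0 = 0 := by
  subst h
  rfl

end Congr

namespace VariableChange

/-! ### The substitution over an extension of the base field -/

section BaseChange

variable {F : Type u} [Field F] (W : WeierstrassCurve F) (C : VariableChange F)
  (L : Type v) [Field L] [Algebra F L]

/-- Base change commutes with changes of variables: `(C • W)_L = C_L • W_L` with
`C_L = C.map (algebraMap F L)` (Mathlib `map_variableChange`). [folklore] -/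
theorem baseChange_smul_eq :
    (C • W).baseChange L = C.map (algebraMap F L) • W.baseChange L :=
  (map_variableChange (W := W) (C := C) (φ := algebraMap F L)).symm

variable [DecidableEq L]

/-- **The isomorphism `W(L) ≃+ (C • W)(L)` induced by a change of variables `C` defined over the
base field `F`**, for any extension `L/F`: the substitution `x = u²x' + r`,
`y = u³y' + u²sx' + t` with the coefficients of `C` viewed in `L` (Silverman, *AEC*, III.1 and
III.3.1(b)), i.e. `pointEquiv (W_L) (C_L)` followed by the transport along `(C • W)_L = C_L • W_L`.
[cite: SilvermanAEC2009, III.3.1(b)] -/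
def pointEquivBaseChange :
    (W.baseChange L).toAffine.Point ≃+ ((C • W).baseChange L).toAffine.Point :=
  (pointEquiv (W.baseChange L) (C.map (algebraMap F L))).trans
    (Affine.Point.congrEquiv (baseChange_smul_eq W C L).symm)

/-- `pointEquivBaseChange` maps `𝒪` to `𝒪`. [folklore] -/
@[simp]
theorem pointEquivBaseChange_zero : pointEquivBaseChange W C L 0 = 0 := by
  simp [pointEquivBaseChange, Affine.Point.congrEquiv_zero]

/-- `pointEquivBaseChange` on an affine point: `(x, y) ↦ (u⁻²(x - r), u⁻³(y - s(x - r) - t))`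
computed with `C_L = C.map (algebraMap F L)`. [cite: SilvermanAEC2009, III.1 Table 3.1] -/
theorem pointEquivBaseChange_some {x y : L} (h : (W.baseChange L).toAffine.Nonsingular x y) :
    pointEquivBaseChange W C L (.some x y h) =
      .some ((C.map (algebraMap F L)).toX x) ((C.map (algebraMap F L)).toY x y)
        ((baseChange_smul_eq W C L) ▸
          (nonsingular_iff (W.baseChange L) (C.map (algebraMap F L)) x y).mpr h) := by
  simp only [pointEquivBaseChange, AddEquiv.trans_apply, pointEquiv_some,
    Affine.Point.congrEquiv_some]

end BaseChange

/-! ### Functoriality in the extension: compatibility with `Point.map` -/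

section Map

variable {F : Type u} [Field F] (W : WeierstrassCurve F) (C : VariableChange F)
  {L : Type v} [Field L] [Algebra F L] {L' : Type w} [Field L'] [Algebra F L']

/-- The new `x`-coordinate is a polynomial expression in `x` and the coefficients of `C`, so an
`F`-algebra homomorphism `f` carries `C_L.toX x` to `C_{L'}.toX (f x)`. [folklore] -/
theorem map_toX (f : L →ₐ[F] L') (x : L) :
    f ((C.map (algebraMap F L)).toX x) = (C.map (algebraMap F L')).toX (f x) := by
  simp only [toX_def, VariableChange.map, Units.coe_map_inv, MonoidHom.coe_coe, map_mul,
    map_pow, map_sub, AlgHom.commutes]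

/-- The new `y`-coordinate is a polynomial expression in `x, y` and the coefficients of `C`, so an
`F`-algebra homomorphism `f` carries `C_L.toY x y` to `C_{L'}.toY (f x) (f y)`. [folklore] -/
theorem map_toY (f : L →ₐ[F] L') (x y : L) :
    f ((C.map (algebraMap F L)).toY x y) = (C.map (algebraMap F L')).toY (f x) (f y) := by
  simp only [toY_def, VariableChange.map, Units.coe_map_inv, MonoidHom.coe_coe, map_mul,
    map_pow, map_sub, AlgHom.commutes]

variable [DecidableEq L] [DecidableEq L']

/-- **Functoriality of the substitution in the field of definition of the points**: for an
`F`-algebra homomorphism `f : L → L'` the isomorphisms `W(L) ≃+ (C • W)(L)` and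
`W(L') ≃+ (C • W)(L')` commute with the maps on points induced by `f`
(`WeierstrassCurve.Affine.Point.map`), since both are given by the same formulas with
coefficients in `F`. Silverman, *AEC*, III.1 with VIII.§1. [folklore] -/
theorem pointEquivBaseChange_map (f : L →ₐ[F] L') (P : (W.baseChange L).toAffine.Point) :
    Affine.Point.map f (pointEquivBaseChange W C L P) =
      pointEquivBaseChange W C L' (Affine.Point.map f P) := by
  rcases P with _ | ⟨x, y, h⟩
  · simp only [← Affine.Point.zero_def, map_zero]
  · rw [pointEquivBaseChange_some, Affine.Point.map_some, Affine.Point.map_some,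
      pointEquivBaseChange_some]
    simp only [map_toX, map_toY]

/-- The inverse isomorphisms also commute with `Point.map f`. [folklore] -/
theorem pointEquivBaseChange_symm_map (f : L →ₐ[F] L')
    (Q : ((C • W).baseChange L).toAffine.Point) :
    Affine.Point.map f ((pointEquivBaseChange W C L).symm Q) =
      (pointEquivBaseChange W C L').symm (Affine.Point.map f Q) := by
  apply (pointEquivBaseChange W C L').injective
  rw [AddEquiv.apply_symm_apply, ← pointEquivBaseChange_map, AddEquiv.apply_symm_apply]

/-- **The substitution is an isomorphism of Galois modules**: `W(L) ≃+ (C • W)(L)` commutes with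
the action `P ↦ P^σ` of every `σ ∈ Aut(L/F)` on coordinates (Silverman, *AEC*, VIII.§1), the case
`f = σ` of `pointEquivBaseChange_map`. [folklore] -/
theorem pointEquivBaseChange_map_algEquiv (σ : L ≃ₐ[F] L) (P : (W.baseChange L).toAffine.Point) :
    pointEquivBaseChange W C L (Affine.Point.map (σ : L →ₐ[F] L) P) =
      Affine.Point.map (σ : L →ₐ[F] L) (pointEquivBaseChange W C L P) :=
  (pointEquivBaseChange_map W C (σ : L →ₐ[F] L) P).symm

end Map

end VariableChange

end WeierstrassCurve

end
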